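import Summits.CriticalPhenomena.CardyFormulaZ2.Theorems.CardyComplexConeParafermionToSLESixFamiliesDiamondTurnCountFrame
import Summits.CriticalPhenomena.CardyFormulaZ2.Theorems.CardyComplexConeParafermionToSLESixFamiliesDiamondTraceStart
import HarnessLib

/-!
# Lattice facts of a marked diamond at small mesh: outside corners, the discrete boundary, far sites,
# the outer corner of the start edge (line `potential-darboux-picard-diamond`, S1t `stub_freeSideTurnCount`, part 2)

Crux `ParafermionToSLESixFamilies` (stmt-CriticalPhenomena-11389), line `potential-darboux-picard-diamond`, stub
`stub_freeSideTurnCount` (S1t). The escape staircase of a touch site runs through FORBIDDEN vertices (sites with no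
inner face around, or `B`-sites) and ends at the start edge `e_a`. This file collects the lattice inputs, for data `E`
with convex `E.Ω = Ω`, `E.δ = δ`, at a mesh where every lattice point of `Ω` belongs to `Ω_δ` (the conclusion of
`eventually_mem_meshDomain_of_isMarkedDiamond`, `…DiamondIdentifyMesh.lean`):

* `exists_corner_not_mem_of_not_isInnerFace` — a non-inner face has a corner outside `Ω`;
* `exists_near_not_mem_of_mem_zdBoundary` — a discrete-boundary site has a lattice point outside `Ω` in its `3 × 3`
  block;
* `corner_faceAt_cases` — the four corners of `faceAt x m` are `x, x + u_m, x + u_{m+1}, x + u_m + u_{m+1}`;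
* `exists_outerCorner_of_isStartCorner` (registered) — for a start corner `(x₀, k₀)` (the face across the start edge
  `{x₀, x₀ + u_{k₀}}` is not inner) one of the two outer corners `x₀ + u_{k₀+3}`, `x₀ + u_{k₀+3} + u_{k₀}` of that
  face has its mesh point outside `Ω`;
* `abs_coord_le_of_mem_carrier`, `not_mem_carrier_of_le_abs` — lattice points of a marked diamond have coordinates
  at most `⌈(‖c‖ + α + β)/δ⌉₊` in absolute value.
-/

noncomputable section

namespace Summit.CriticalPhenomena.CardyFormulaZ2.Cruxes.ParafermionToSLESixFamilies.PotentialDarbouxPicardDiamond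

open Set Metric Complex
open Literature.Probability Literature.Probability.LatticeModels Literature.Probability.Percolation
open Literature.Probability.LatticeModels.DiscreteDobrushin
open Literature.Probability.RandomPlanarGeometry

/-! ## Outside corners and the discrete boundary -/

section Generic

variable {Ω : Set ℂ} {δ : ℝ} {E : DiscreteDobrushin}

/-- **A non-inner face has a corner outside `Ω`** (at a mesh where all lattice points of the convex `Ω` lie in `Ω_δ`). -/
theorem exists_corner_not_mem_of_not_isInnerFace (hconv : Convex ℝ Ω)
    (hgood : ∀ x : Site 2, meshPoint δ x ∈ Ω → x ∈ meshDomain Ω δ) (hΩ : E.Ω = Ω) (hδ : E.δ = δ) {f : Site 2}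
    (hf : ¬ E.IsInnerFace f) : ∃ v : Site 2, IsCorner v f ∧ meshPoint δ v ∉ Ω := by
  by_contra h
  simp only [not_exists, not_and, not_not] at h
  exact hf (isInnerFace_of_forall_corner_mem hconv hgood hΩ hδ h)

/-- **A discrete-boundary site has an outside lattice point in its `3 × 3` block.** -/
theorem exists_near_not_mem_of_mem_zdBoundary (hconv : Convex ℝ Ω)
    (hgood : ∀ x : Site 2, meshPoint δ x ∈ Ω → x ∈ meshDomain Ω δ) (hΩ : E.Ω = Ω) (hδ : E.δ = δ) {x : Site 2}
    (hx : x ∈ E.zdBoundary) : ∃ y : Site 2, (∀ i, |y i - x i| ≤ 1) ∧ meshPoint δ y ∉ Ω := by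
  rcases hx with hx | ⟨y, -, -, f, hf, hxf, hyf⟩
  · rw [mem_meshBoundary_iff, hΩ, hδ] at hx
    obtain ⟨hxD, y, hadj, hnadj⟩ := hx
    refine ⟨y, fun i => ?_, fun hy => hnadj ?_⟩
    · obtain ⟨j, hj | hj⟩ := (zdGraph_adj_iff x y).1 hadj <;> rw [hj] <;> fin_cases i <;> fin_cases j <;> simp
    · rw [discreteDomainGraph_adj_iff]
      exact ⟨meshGraph_adj_of_convex hconv hadj (meshDomain_subset_meshVertices _ _ hxD) hy, hxD, hgood y hy⟩
  · obtain ⟨v, hv, hvout⟩ := exists_corner_not_mem_of_not_isInnerFace hconv hgood hΩ hδ hf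
    exact ⟨v, fun i => abs_sub_le_one_of_isCorner hxf hv i, hvout⟩

/-- Discrete-boundary sites have their mesh point in the domain. -/
theorem mem_of_mem_zdBoundary {x : Site 2} (hx : x ∈ E.zdBoundary) : meshPoint E.δ x ∈ E.Ω :=
  meshDomain_subset_meshVertices _ _ (E.zdBoundary_subset_meshDomain hx)

/-- **The four corners of `faceAt x m`** are `x`, `x + u_m`, `x + u_{m+1}`, `x + u_m + u_{m+1}`. -/
theorem corner_faceAt_cases {v x : Site 2} {m : Fin 4} (h : IsCorner v (faceAt x m)) :
    v = x ∨ v = x + cornerUnit m ∨ v = x + cornerUnit (m + 1) ∨ v = x + cornerUnit m + cornerUnit (m + 1) := by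
  have h0 := h 0
  have h1 := h 1
  have key : ∀ v w : Site 2, v = w ↔ v 0 = w 0 ∧ v 1 = w 1 :=
    fun v w => ⟨fun h => by simp [h], fun h => by ext i; fin_cases i <;> simp [h.1, h.2]⟩
  rw [key, key, key, key]
  fin_cases m <;> simp [faceAt, cornerOff, cornerUnit] at h0 h1 ⊢ <;> omega

/-- A site whose mesh point is outside the domain has no inner face around it. -/
theorem forall_not_isInnerFace_of_not_mem {v : Site 2} (hv : meshPoint E.δ v ∉ E.Ω) (i : Fin 4) :
    ¬ E.IsInnerFace (faceAt v i) :=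
  not_isInnerFace_of_corner_not_mem (isCorner_faceAt v i) hv

/-- **The outer corner of the start edge** (registered helper of `stub_freeSideTurnCount`). For a start corner
`(x₀, k₀)` of data `E` on a convex domain read at a mesh where all lattice points of the domain belong to `Ω_δ`, the
face across the start edge has an outside corner, which is `x₀ + u_{k₀+3}` or `x₀ + u_{k₀+3} + u_{k₀}` (the other two
corners `x₀ ∈ A`, `x₀ + u_{k₀} ∈ B` are sites of `Ω_δ`). -/
theorem exists_outerCorner_of_isStartCorner : ∀ (E : DiscreteDobrushin), Convex ℝ E.Ω → (∀ x : Site 2, meshPoint E.δ x ∈ E.Ω → x ∈ meshDomain E.Ω E.δ) → ∀ (c₀ : Site 2 × Fin 4), E.IsStartCorner c₀ → ∃ v : Site 2, (v = c₀.1 + cornerUnit (c₀.2 + 3) ∨ v = c₀.1 + cornerUnit (c₀.2 + 3) + cornerUnit c₀.2) ∧ meshPoint E.δ v ∉ E.Ω := by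
  intro E hconv hgood c₀ hc₀
  obtain ⟨v, hv, hvout⟩ := exists_corner_not_mem_of_not_isInnerFace hconv hgood rfl rfl hc₀.isOutEdge.2
  have hA : meshPoint E.δ c₀.1 ∈ E.Ω := mem_of_mem_zdBoundary (E.zdArcA_subset_zdBoundary hc₀.mem_zdArcA)
  have hB : meshPoint E.δ (c₀.1 + cornerUnit c₀.2) ∈ E.Ω := mem_of_mem_zdBoundary (E.zdArcB_subset_zdBoundary hc₀.mem_zdArcB)
  have h31 : c₀.2 + 3 + 1 = c₀.2 := (fin4_escape_arith c₀.2).1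
  rcases corner_faceAt_cases hv with rfl | h | h | h
  · exact absurd hA hvout
  · exact ⟨v, Or.inl h, hvout⟩
  · rw [h31] at h; rw [h] at hvout; exact absurd hB hvout
  · rw [h31] at h
    refine ⟨v, Or.inr ?_, hvout⟩
    rw [h]

end Generic

/-! ## Far sites of a marked diamond -/

section Diamond

variable {D : DobrushinDomain} {c : ℂ} {α β δ : ℝ}

/-- **Lattice points of the diamond are within `(‖c‖ + α + β)/δ` of the origin in each coordinate.** -/
theorem abs_coord_lt_of_mem_carrier (hD : D.carrier = {z | |(dRot c z).re| < α ∧ |(dRot c z).im| < β})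
    (hδ : 0 < δ) {v : Site 2} (hv : meshPoint δ v ∈ D.carrier) (i : Fin 2) : |(v i : ℝ)| < (‖c‖ + α + β) / δ := by
  rw [hD] at hv
  obtain ⟨h1, h2⟩ := hv
  have hw : ‖dRot c (meshPoint δ v)‖ < α + β :=
    lt_of_le_of_lt (norm_le_abs_re_add_abs_im _) (by linarith)
  have hn : ‖dRot c (meshPoint δ v)‖ = ‖meshPoint δ v - c‖ := by
    rw [dRot, norm_mul, norm_exp_neg_pi_div_four_mul_I, mul_one]
  have hz : ‖meshPoint δ v‖ < ‖c‖ + α + β := by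
    have := norm_le_norm_add_norm_sub' (meshPoint δ v) c
    rw [norm_sub_rev] at hn
    linarith [norm_sub_rev (meshPoint δ v) c]
  have hcoord : |(v i : ℝ)| * δ ≤ ‖meshPoint δ v‖ := by
    fin_cases i
    · have := abs_re_le_norm (meshPoint δ v)
      rw [meshPoint_re, abs_mul, abs_of_pos hδ] at this
      simpa [mul_comm] using this
    · have := abs_im_le_norm (meshPoint δ v)
      rw [meshPoint_im, abs_mul, abs_of_pos hδ] at this
      simpa [mul_comm] using this
  rw [lt_div_iff₀ hδ]
  linarith

/-- **Integer form**: the coordinates of a lattice point of the diamond are at most `⌈(‖c‖ + α + β)/δ⌉₊`. -/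
theorem abs_coord_le_of_mem_carrier (hD : D.carrier = {z | |(dRot c z).re| < α ∧ |(dRot c z).im| < β})
    (hδ : 0 < δ) {v : Site 2} (hv : meshPoint δ v ∈ D.carrier) :
    |v 0| ≤ (⌈(‖c‖ + α + β) / δ⌉₊ : ℕ) ∧ |v 1| ≤ (⌈(‖c‖ + α + β) / δ⌉₊ : ℕ) := by
  have key : ∀ i : Fin 2, |v i| ≤ (⌈(‖c‖ + α + β) / δ⌉₊ : ℕ) := fun i => by
    have h1 := abs_coord_lt_of_mem_carrier hD hδ hv i
    have h2 : (‖c‖ + α + β) / δ ≤ (⌈(‖c‖ + α + β) / δ⌉₊ : ℝ) := Nat.le_ceil _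
    have h3 : ((|v i| : ℤ) : ℝ) < ((⌈(‖c‖ + α + β) / δ⌉₊ : ℕ) : ℝ) := by
      rw [Int.cast_abs]; linarith
    exact_mod_cast h3.le
  exact ⟨key 0, key 1⟩

/-- **Far lattice points are outside the diamond.** -/
theorem not_mem_carrier_of_le_abs (hD : D.carrier = {z | |(dRot c z).re| < α ∧ |(dRot c z).im| < β})
    (hδ : 0 < δ) {v : Site 2} (hv : (⌈(‖c‖ + α + β) / δ⌉₊ : ℕ) + 1 ≤ |v 0| ∨ (⌈(‖c‖ + α + β) / δ⌉₊ : ℕ) + 1 ≤ |v 1|) :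
    meshPoint δ v ∉ D.carrier := by
  intro h
  obtain ⟨h0, h1⟩ := abs_coord_le_of_mem_carrier hD hδ h
  rcases hv with hv | hv <;> omega

end Diamond

end Summit.CriticalPhenomena.CardyFormulaZ2.Cruxes.ParafermionToSLESixFamilies.PotentialDarbouxPicardDiamond

end
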